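import Summits.Ventures.HodgeRepro2.T5AbelianWeights
import Summits.Ventures.HodgeRepro2.T5UnitarianTrick

/-!
# Weights of a compact group are unimodular: `‖weight g‖ = 1`

Blind cell `pub-hodge-repro2`, seat p1 (gen 12), Tier-5 kernel support for the S4.7 row «the weights of
SO(2)» (P2′: the SO(2)-weights `e^{inθ}` are unitary characters).

For a stable line spanned by `w ≠ 0` in a continuous representation `π` of a compact group, the weight
`c g` (with `π g w = c g • w`, `T5AbelianWeights.weight`) has modulus one: the averaged inner product of
the unitarian trick is `π`-invariant (`T5UnitarianTrick.avgInner_map_map`), so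
`|c g|² ⟨w|w⟩ = ⟨π g w|π g w⟩ = ⟨w|w⟩` with `⟨w|w⟩ ≠ 0` (`avgInner_definite`).  Consequently
`weight g⁻¹ = conj (weight g)`.  No unitarity of `π` for the given inner product is assumed.

Print: Goodman–Wallach GTM 255 §3.3.4 (the unitarian trick) + §4.3.2.  Honest scope (unchanged):
compact groups, finite-dimensional representations; the weights of the infinite-dimensional π₃⁺ are
not an instance.
-/

namespace Summit.Ventures.HodgeRepro2.T5UnimodularWeights

open MeasureTheory T5SchurOrthogonality T5CompleteReducibility T5UnitarianTrick T5AbelianWeights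

variable {G : Type*} [Group G] [TopologicalSpace G] [IsTopologicalGroup G]
  [MeasurableSpace G] [BorelSpace G] [CompactSpace G]
variable {V : Type*} [NormedAddCommGroup V] [InnerProductSpace ℂ V]
variable (μ : Measure G) [IsProbabilityMeasure μ] [μ.IsOpenPosMeasure] [μ.IsMulLeftInvariant]
variable (π : G →* V →L[ℂ] V) (hπ : Continuous π)
variable {W : Submodule ℂ V} (hW : IsStable π W) (h1 : Module.finrank ℂ W = 1)
variable {w : V} (hw : w ∈ W) (hw0 : w ≠ 0)

omit [TopologicalSpace G] [IsTopologicalGroup G] [BorelSpace G] [CompactSpace G]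
  [IsProbabilityMeasure μ] [μ.IsOpenPosMeasure] [μ.IsMulLeftInvariant] in
/-- The averaged inner product is linear in the second slot (from conjugate symmetry and
conjugate-linearity in the first slot). -/
theorem avgInner_smul_right (x y : V) (r : ℂ) :
    avgInner μ π x (r • y) = r * avgInner μ π x y := by
  rw [← avgInner_conj_symm, avgInner_smul_left, map_mul, Complex.conj_conj, avgInner_conj_symm]

include μ hπ in
/-- **Weights are unimodular**: `‖weight g‖ = 1` for every stable line of a continuous representation
of a compact group (no unitarity assumed — the averaged inner product is invariant). -/
theorem norm_weight_eq_one (g : G) : ‖weight π hW h1 hw hw0 g‖ = 1 := by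
  set c := weight π hW h1 hw hw0 g with hc
  have hinv : avgInner μ π (π g w) (π g w) = avgInner μ π w w := avgInner_map_map μ π g w w
  rw [weight_spec π hW h1 hw hw0 g, ← hc, avgInner_smul_left, avgInner_smul_right,
    ← mul_assoc] at hinv
  have ha : avgInner μ π w w ≠ 0 := fun h => hw0 (avgInner_definite μ π hπ w h)
  have hcc : (starRingEnd ℂ) c * c = 1 :=
    mul_right_cancel₀ ha (hinv.trans (one_mul _).symm)
  rw [Complex.conj_mul'] at hcc
  have hsq : ‖c‖ ^ 2 = 1 := by exact_mod_cast hcc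
  exact (pow_eq_one_iff_of_nonneg (norm_nonneg c) two_ne_zero).mp hsq

include μ hπ in
/-- `weight g⁻¹ = conj (weight g)` (a unimodular character). -/
theorem weight_inv_eq_conj (g : G) :
    weight π hW h1 hw hw0 g⁻¹ = (starRingEnd ℂ) (weight π hW h1 hw hw0 g) := by
  have hmul : weight π hW h1 hw hw0 g⁻¹ * weight π hW h1 hw hw0 g = 1 := by
    rw [← weight_mul, inv_mul_cancel, weight_one]
  have hcc : (starRingEnd ℂ) (weight π hW h1 hw hw0 g) * weight π hW h1 hw hw0 g = 1 := by
    rw [Complex.conj_mul', norm_weight_eq_one μ π hπ hW h1 hw hw0 g]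
    simp
  exact mul_right_cancel₀ (weight_ne_zero π hW h1 hw hw0 g) (hmul.trans hcc.symm)

end Summit.Ventures.HodgeRepro2.T5UnimodularWeights
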